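import Literature.Probability.LatticeModels.TorusFourierMomentBound
import HarnessLib

/-!
# Decay of lattice Fourier sums on the torus from finite differences of the symbol (discrete integration by parts)

Topic `Literature/Probability/LatticeModels`; the converse companion of `TorusFourierMomentBound.lean`.  There the
differences of a character sum were bounded by the moments of the coefficients; here a character sum
`g(x) = Σ_k χ_k(x) • ĝ(k)` over the dual torus `(ℤ/Lℤ)^d` is shown to DECAY in `x` when the symbol `ĝ` has small
iterated differences — the finite-volume, fully discrete form of the integration by parts by which the single-scale
propagators of a lattice fermion model are bounded in position space (Benfatto–Giuliani–Mastropietro 2006, Lemma 2.2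
and the footnote to (2.36): "our bounds can be adapted also to the finite `L` case", with the discrete derivatives
(2.36aa); Benfatto–Mastropietro 2001, §2.3).  For an arbitrary dual-lattice step `v` (any integer direction, not only
the axes — anisotropic sector bounds need differences along integer approximants of the tangent direction):

* `sum_torusChar_smul_comp_add` — shifting the symbol multiplies the sum by a character:
  `Σ_k χ_k(x) • ĝ(k + v) = conj χ_v(x) • Σ_k χ_k(x) • ĝ(k)`;
* `sum_torusChar_smul_fwdDiff_iter` — hence `Σ_k χ_k(x) • (Δ_v^N ĝ)(k) = (conj χ_v(x) - 1)^N • g(x)`;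
* `torusChar_eq_stdAddChar_sum` (`χ_v(x) = e(Σⱼ vⱼxⱼ)`) and **`le_norm_torusChar_sub_one`** — the chord bound from BELOW: `4|ã|/L ≤ ‖χ_v(x) - 1‖`, `ã = ZMod.valMinAbs (Σⱼ vⱼ xⱼ)`;
* **`norm_sum_torusChar_smul_mul_pow_le`** — the decay bound `‖g(x)‖ · (4|ã|/L)^N ≤ Σ_k ‖(Δ_v^N ĝ)(k)‖`: `N`
  differences of the symbol, each small, buy polynomial decay of `g` in the direction dual to `v`.

Everything is proved; no definitions, no named facts. [folklore]

## Sources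

G. Benfatto, A. Giuliani, V. Mastropietro, Ann. Henri Poincaré 7 (2006) 809–898, Lemma 2.2, (2.36aa) and footnote ¹
(`BenfattoGiulianiMastropietro2006`); G. Benfatto, V. Mastropietro, Rev. Math. Phys. 13 (2001) 1323–1435, §2.3
(`BenfattoMastropietro2001`); S. Friedli, Y. Velenik, *Statistical Mechanics of Lattice Systems* (2017), §10.4
(`FriedliVelenik2017`).
-/

noncomputable section

open Finset Complex
open scoped Real ComplexConjugate

namespace Literature.Probability.LatticeModels

variable {d L : ℕ} [NeZero L] {E : Type*} [NormedAddCommGroup E] [NormedSpace ℂ E]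

/-! ### Shifting the symbol -/

/-- **Shifting the symbol multiplies the character sum by a character**:
`Σ_k χ_k(x) • ĝ(k + v) = conj χ_v(x) • Σ_k χ_k(x) • ĝ(k)`. [folklore] -/
theorem sum_torusChar_smul_comp_add (ĝ : TorusSite d L → E) (v x : TorusSite d L) :
    ∑ k, torusChar k x • ĝ (k + v) = conj (torusChar v x) • ∑ k, torusChar k x • ĝ k := by
  rw [Finset.smul_sum]
  exact Fintype.sum_equiv (Equiv.addRight v) _ _ fun k => by
    show torusChar k x • ĝ (k + v) = conj (torusChar v x) • (torusChar (k + v) x • ĝ (k + v))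
    rw [smul_smul, torusChar_add_left,
      show conj (torusChar v x) * (torusChar k x * torusChar v x) = torusChar k x by
        rw [mul_comm, mul_assoc, torusChar_mul_conj, mul_one]]

/-- **Iterated differences of the symbol**: `Σ_k χ_k(x) • (Δ_v^N ĝ)(k) = (conj χ_v(x) - 1)^N • Σ_k χ_k(x) • ĝ(k)`. [folklore] -/
theorem sum_torusChar_smul_fwdDiff_iter (v x : TorusSite d L) :
    ∀ (N : ℕ) (ĝ : TorusSite d L → E),
      ∑ k, torusChar k x • ((fwdDiff v)^[N] ĝ) k = (conj (torusChar v x) - 1) ^ N • ∑ k, torusChar k x • ĝ k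
  | 0, ĝ => by simp
  | N + 1, ĝ => by
    rw [Function.iterate_succ_apply, sum_torusChar_smul_fwdDiff_iter v x N (fwdDiff v ĝ), pow_succ, ← smul_smul]
    congr 1
    simp only [fwdDiff, smul_sub, Finset.sum_sub_distrib, sum_torusChar_smul_comp_add, sub_smul, one_smul]

/-! ### The chord bound from below -/

/-- A character of a sum is the product of the characters. [folklore] -/
theorem stdAddChar_sum_eq_prod {ι : Type*} (s : Finset ι) (f : ι → ZMod L) :
    (ZMod.stdAddChar (∑ j ∈ s, f j) : ℂ) = ∏ j ∈ s, (ZMod.stdAddChar (f j) : ℂ) := by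
  classical
  induction s using Finset.induction_on with
  | empty => simp
  | insert i s hi ih => rw [sum_insert hi, prod_insert hi, AddChar.map_add_eq_mul, ih]

/-- **`χ_v(x) = e(Σⱼ vⱼ xⱼ)`.** [folklore] -/
theorem torusChar_eq_stdAddChar_sum (v x : TorusSite d L) : torusChar v x = ZMod.stdAddChar (∑ j, v j * x j) := by
  rw [torusChar, stdAddChar_sum_eq_prod]

/-- **The chord bound from below**: `4|ã|/L ≤ ‖χ_v(x) - 1‖` with `ã = ZMod.valMinAbs (Σⱼ vⱼ xⱼ)` the minimal
representative (`|ã| ≤ L/2`, so the arc `2π|ã|/L` is at most `π` and `2|sin(θ/2)| ≥ (2/π)|θ|`). [folklore] -/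
theorem le_norm_torusChar_sub_one (v x : TorusSite d L) :
    4 * |((∑ j, v j * x j).valMinAbs : ℝ)| / L ≤ ‖torusChar v x - 1‖ := by
  have hL : (0 : ℝ) < L := Nat.cast_pos.2 (Nat.pos_of_ne_zero (NeZero.ne L))
  set a : ZMod L := ∑ j, v j * x j with ha_def
  have ha : (ZMod.stdAddChar a : ℂ) = Complex.exp (Complex.I * ((2 * π * (a.valMinAbs : ℝ) / L : ℝ) : ℂ)) := by
    conv_lhs => rw [← ZMod.coe_valMinAbs a, ZMod.stdAddChar_coe]
    congr 1
    push_cast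
    ring
  rw [torusChar_eq_stdAddChar_sum, ← ha_def, ha, Complex.norm_exp_I_mul_ofReal_sub_one, Real.norm_eq_abs, abs_mul,
    abs_of_pos (two_pos : (0 : ℝ) < 2)]
  -- `|θ/2| = π|ã|/L ≤ π/2`
  have habs : |(a.valMinAbs : ℝ)| ≤ L / 2 := by
    have h := ZMod.natAbs_valMinAbs_le a
    have h2 : (a.valMinAbs.natAbs : ℝ) * 2 ≤ L := by exact_mod_cast (show a.valMinAbs.natAbs * 2 ≤ L by omega)
    rw [← Int.cast_abs, Int.abs_eq_natAbs, Int.cast_natCast]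
    linarith
  have hy : |2 * π * (a.valMinAbs : ℝ) / L / 2| ≤ π / 2 := by
    rw [show 2 * π * (a.valMinAbs : ℝ) / L / 2 = π / L * (a.valMinAbs : ℝ) by ring, abs_mul, abs_of_pos (by positivity)]
    calc π / L * |(a.valMinAbs : ℝ)| ≤ π / L * (L / 2) := mul_le_mul_of_nonneg_left habs (by positivity)
      _ = π / 2 := by field_simp
  -- Jordan's inequality `(2/π)|y| ≤ |sin y|` on `|y| ≤ π/2` (both signs)
  have hsin : ∀ {y : ℝ}, |y| ≤ π / 2 → 2 / π * |y| ≤ |Real.sin y| := by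
    intro y hy
    rcases le_or_gt 0 y with h | h
    · rw [abs_of_nonneg h] at hy ⊢
      exact (Real.mul_le_sin h hy).trans (le_abs_self _)
    · rw [abs_of_neg h] at hy ⊢
      calc 2 / π * -y ≤ Real.sin (-y) := Real.mul_le_sin (by linarith) hy
        _ = |Real.sin y| := by rw [Real.sin_neg, abs_of_neg (Real.sin_neg_of_neg_of_neg_pi_lt h (by linarith [Real.pi_pos]))]
  have hsin := hsin hy
  have hy' : |2 * π * (a.valMinAbs : ℝ) / L / 2| = π / L * |(a.valMinAbs : ℝ)| := by
    rw [show 2 * π * (a.valMinAbs : ℝ) / L / 2 = π / L * (a.valMinAbs : ℝ) by ring, abs_mul, abs_of_pos (by positivity : (0 : ℝ) < π / L)]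
  rw [hy'] at hsin
  calc 4 * |(a.valMinAbs : ℝ)| / L = 2 * (2 / π * (π / L * |(a.valMinAbs : ℝ)|)) := by field_simp; ring
    _ ≤ 2 * |Real.sin (2 * π * (a.valMinAbs : ℝ) / L / 2)| := mul_le_mul_of_nonneg_left hsin zero_le_two

/-! ### The decay bound -/

/-- **Decay from differences** (discrete integration by parts, Benfatto–Giuliani–Mastropietro 2006, Lemma 2.2 at finite `L`):
for every dual-lattice step `v`, every `x` and every `N`,
`‖Σ_k χ_k(x) • ĝ(k)‖ · (4|ã|/L)^N ≤ Σ_k ‖(Δ_v^N ĝ)(k)‖` with `ã = ZMod.valMinAbs (Σⱼ vⱼ xⱼ)`.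
[cite: BenfattoGiulianiMastropietro2006, Lemma 2.2 and (2.36aa)] -/
theorem norm_sum_torusChar_smul_mul_pow_le (ĝ : TorusSite d L → E) (v x : TorusSite d L) (N : ℕ) :
    ‖∑ k, torusChar k x • ĝ k‖ * (4 * |((∑ j, v j * x j).valMinAbs : ℝ)| / L) ^ N ≤ ∑ k, ‖((fwdDiff v)^[N] ĝ) k‖ := by
  have hL : (0 : ℝ) < L := Nat.cast_pos.2 (Nat.pos_of_ne_zero (NeZero.ne L))
  have hconj : ‖conj (torusChar v x) - 1‖ = ‖torusChar v x - 1‖ := by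
    rw [show conj (torusChar v x) - 1 = conj (torusChar v x - 1) by rw [map_sub, map_one], Complex.norm_conj]
  calc ‖∑ k, torusChar k x • ĝ k‖ * (4 * |((∑ j, v j * x j).valMinAbs : ℝ)| / L) ^ N
      ≤ ‖∑ k, torusChar k x • ĝ k‖ * ‖torusChar v x - 1‖ ^ N :=
        mul_le_mul_of_nonneg_left (pow_le_pow_left₀ (by positivity) (le_norm_torusChar_sub_one v x) N) (norm_nonneg _)
    _ = ‖∑ k, torusChar k x • ((fwdDiff v)^[N] ĝ) k‖ := by
        rw [sum_torusChar_smul_fwdDiff_iter, norm_smul, norm_pow, hconj, mul_comm]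
    _ ≤ ∑ k, ‖((fwdDiff v)^[N] ĝ) k‖ :=
        (norm_sum_le _ _).trans (le_of_eq (sum_congr rfl fun k _ => by rw [norm_smul, norm_torusChar, one_mul]))

end Literature.Probability.LatticeModels
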